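import Literature.NumberTheory.NumberFields.EisensteinFieldIntegers
import Literature.NumberTheory.GaloisRepresentations.KummerCubicCharacterPeriodicity
import Literature.NumberTheory.GaloisRepresentations.CubicJacobiSumPrimary
import Literature.NumberTheory.LFunctions.TwistedDedekindCoefficients
import Literature.NumberTheory.LFunctions.PlaneLatticeCosetSectorSums
import Mathlib.Algebra.QuadraticAlgebra.NormDeterminant
import HarnessLib

/-!
# The Grössencharacters `ν_{D,r,m}` of `ℚ(ζ₃)` built from the cubic residue symbol, and their
# partial sums `Σ_{N(I) ≤ x} ν(I) = O(N(D) m x^{3/4})`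

Topic `NumberTheory/LFunctions`; namespace `Literature.NumberTheory.LFunctions.EisensteinGrossen`.
Definitions with bodies (`w`, `embC`, `primGen`, `psiLoc`, `psi`, `Adm`, `nuFun`, `grossenNu`,
`idealsUpTo`, `intBox`, `primElts`, `classPt`, `idxBox`, `Cw`) and theorems; no named fact (D-0026).
Filed in support of the named fact `murty_petersson_newform_lower_bound`: for the `j = 0` CM family
`y² = x³ + B` the symmetric-square `L`-function factors through `L(s, ν_E)` with
`ν_E(𝔭) = χ_𝔭(D₀) (ϖ_𝔭/|ϖ_𝔭|)²` (`ComplexMultiplicationDeuring0Square`), a member of the family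
constructed here on `K3 = ℚ(ζ₃)` (`NumberFields/EisensteinField`, Mathlib's `QuadraticAlgebra ℚ (−1) (−1)`):

`ν_{D,r,m}(I) = ψ_D(I)^r · (e(α_I)/|e(α_I)|)^m` for `I ≠ 0` prime to `3D`, `0` otherwise,

where `α_I` is the PRIMARY generator (`≡ 1 (mod 3)`, `primGen`; existence/uniqueness from
`CubicJacobiSumPrimary.exists_units_mul_sub_one_mem_span_three` / `eq_of_span_eq_of_sub_one_mem_span_three`,
Ireland–Rosen Prop. 9.3.5), `e = embC : ζ ↦ e^{2πi/3}` (`QuadraticAlgebra.lift`), and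
`ψ_D = artinSymbol` of the Kummer character of `K3(∛D)/K3` (`KummerCubicCharacterPeriodicity`:
`ψ_D(𝔭) = e(χ_𝔭(D))` for `𝔭 ∤ 3D`, PERIODIC modulo `9D`), `ψ_D = 1` if `D` is a cube.

* `grossenNu D r m : Ideal (𝓞 K3) →*₀ ℂ` (multiplicativity from `artinSymbol_mul`, `primGen_mul` and
  the multiplicativity of `(z/‖z‖)^m`), `norm_grossenNu_le` (`‖ν‖ ≤ 1`), `grossenNu_sq`
  (`ν_{D,r,m}² = ν_{D,2r,2m}` pointwise — the companion in the zero-free-region datum),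
  `grossenNu_span_of_primary`;
* `absNorm_span_singleton_eq` — `N((x)) = ‖e(x)‖²` (`Algebra.norm ℚ = ` norm form,
  `QuadraticAlgebra.det_toLinearMap_eq_norm`);
* `sum_Icc_twistCount_eq`, `sum_idealsUpTo_eq_sum_primElts` — `Σ_{n≤N} a_ν(n) = Σ_{α} ν((α))` over the
  primary admissible `α` of norm `≤ N` (`I ↦ α_I` bijective);
* `fibre_eq_image` — a congruence class `α ≡ β₀ (mod 9D)` of such `α` is the image of
  `p ↦ β₀ + 9D(p₁ + p₂ζ)`, and `e` maps it onto the lattice coset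
  `e(β₀) + e(9D)(ℤ + ℤw)` (`embC_classPt`), with `N(α) ≤ N ↔ ‖e(α)‖ ≤ √N`;
* `norm_sum_fibre_le` — on a class `ψ_D` is constant (`psi_span_eq_of_sub_mem`), so the class sum is a
  sector sum over a plane-lattice coset and `PlaneLatticeCosetSectorSums.norm_sum_sectorWeight_le`
  gives `≤ C_w m (√N+1)(N^{1/4}+1)` uniformly (`‖e(9D)‖ ≥ 9`);
* **`norm_sum_twistCount_grossenNu_le`**, **`norm_sum_twistCount_grossenNu_le_rpow`** —
  `‖Σ_{n ≤ N} a_ν(n)‖ ≤ N(9D)·C_w·m·(√N+1)(N^{1/4}+1) ≤ 4 C_w N(9D) m · N^{3/4}` (`N ≥ 1`, `m ≥ 1`,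
  `D ≠ 0`): the hypothesis of `LSeriesContinuationOfPartialSums` with `θ = 3/4` and a constant
  POLYNOMIAL in `N(D)` and `m` — the source of the polynomial conductor dependence downstream.

## References

* E. Hecke, *Eine neue Art von Zetafunktionen und ihre Beziehungen zur Verteilung der Primzahlen
  II*, Math. Z. 6 (1920), 11–51, §6. [cite: HeckeMathZ1920, §6]
* K. Ireland, M. Rosen, *A Classical Introduction to Modern Number Theory*, 2nd ed. (1990), Ch. 9
  §3 (Prop. 9.3.3, 9.3.5, Theorem 1), Ch. 18 §4–§7 (the Hecke character of `y² = x³ + D`).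
  [cite: IrelandRosen1990, Ch. 9 §3 Prop. 9.3.5]

## Mathlib / tree search

Tree: `EisensteinFieldIntegers` (`K3`, `mkInt`, `exists_eq_mkInt`, `norm_mk`, PID, units),
`CubicJacobiSumPrimary` (primary elements for `𝔣 = (3)`), `KummerCubicCharacterPeriodicity`
(`kummerChar`, `isGalois_kummerField`, `artinSymbol_kummerChar_eq_of_sub_mem_span`,
`artinSymbol_pow_three_eq_one`, `isEmpty_ringHom_real`), `AbelianFrobeniusDensity.artinSymbol(_mul)`,
`TwistedDedekindCoefficients` (`twistCount`, `idealsOfNorm`), `PlaneLatticeCosetSectorSums`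
(`sectorWeight`, `cosetPt`, `abs_snd_mul_im_add_le`, `abs_fst_add_le`, `norm_sum_sectorWeight_le`);
`PrimaryGeneratorHeckeCharacter` treats general `𝔣` abstractly (not imported: the `(3)`-case API is
lighter here). Mathlib: `QuadraticAlgebra.lift`, `QuadraticAlgebra.det_toLinearMap_eq_norm`,
`Ideal.absNorm_span_singleton`, `Algebra.coe_norm_int`, `Ideal.finiteQuotientOfFreeOfNeBot`,
`Ideal.absNorm_apply`, `Submodule.cardQuot_apply`, `Finset.sum_fiberwise`, `Finset.sum_nbij'`,
`Finset.sum_image`, `Ideal.isCoprime_span_singleton_iff`, `IsCoprime.mul_left_iff`.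
-/

noncomputable section

open NumberField IsDedekindDomain Complex Finset
open scoped ComplexConjugate

namespace Literature.NumberTheory.LFunctions.EisensteinGrossen

open Literature.NumberTheory.NumberFields Literature.NumberTheory.NumberFields.K3
open Literature.NumberTheory.GaloisRepresentations

/-! ### The complex embedding `a + bζ ↦ a + b e^{2πi/3}` of `K3` -/

/-- `w = e^{2πi/3} = −1/2 + (√3/2) i`. [folklore] -/
def w : ℂ := ⟨-1 / 2, Real.sqrt 3 / 2⟩

/-- `w² = −1 − w`. [folklore] -/
theorem w_mul_w : w * w = (-1 : ℚ) • (1 : ℂ) + (-1 : ℚ) • w := by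
  have h3 : Real.sqrt 3 * Real.sqrt 3 = 3 := Real.mul_self_sqrt (by norm_num)
  apply Complex.ext <;> simp [w, Complex.mul_re, Complex.mul_im] <;> nlinarith [h3]

/-- `‖w‖ = 1`. [folklore] -/
theorem norm_w : ‖w‖ = 1 := by
  have h3 : Real.sqrt 3 ^ 2 = 3 := Real.sq_sqrt (by norm_num)
  have : ‖w‖ ^ 2 = 1 := by
    rw [Complex.sq_norm, Complex.normSq_mk]; unfold w; simp; nlinarith [h3]
  nlinarith [norm_nonneg w]

/-- `Im w = √3/2 > 0`. [folklore] -/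
theorem w_im_pos : 0 < w.im := by
  show 0 < Real.sqrt 3 / 2
  positivity

/-- `Im w = √3/2`. [folklore] -/
theorem w_im : w.im = Real.sqrt 3 / 2 := rfl

/-- `Re w = -1/2`. [folklore] -/
theorem w_re : w.re = -1 / 2 := rfl

/-- **The complex embedding of `K3 = ℚ(ζ₃)`** sending `ζ ↦ w = e^{2πi/3}`. [folklore] -/
def embC : K3 →ₐ[ℚ] ℂ := QuadraticAlgebra.lift ⟨w, w_mul_w⟩

/-- `embC (a + bζ) = a + b w`. [folklore] -/
theorem embC_mk (a b : ℚ) : embC (⟨a, b⟩ : K3) = (a : ℂ) + (b : ℂ) * w := by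
  change a • (1 : ℂ) + b • w = _
  rw [Rat.smul_one_eq_cast, Rat.smul_def]

/-- `embC` on integers `a + bζ`. [folklore] -/
theorem embC_mkInt (a b : ℤ) : embC ((mkInt a b : 𝓞 K3) : K3) = (a : ℂ) + (b : ℂ) * w := by
  rw [coe_mkInt, embC_mk]; push_cast; rfl

/-- `embC ζ = w`. [folklore] -/
theorem embC_zeta : embC zeta = w := by
  rw [zeta_eq, embC_mk]; simp

/-- **`‖embC(a + bζ)‖² = a² − ab + b²`** (the norm form). [folklore] -/
theorem norm_sq_embC_mk (a b : ℚ) : ‖embC (⟨a, b⟩ : K3)‖ ^ 2 = (a : ℝ) ^ 2 - a * b + (b : ℝ) ^ 2 := by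
  rw [embC_mk]
  have e : ((a : ℂ) + (b : ℂ) * w) = ⟨a - b / 2, b * (Real.sqrt 3 / 2)⟩ := by
    apply Complex.ext
    · simp [w_re, w_im]; ring
    · simp [w_re, w_im]
  rw [e, Complex.sq_norm, Complex.normSq_mk]
  have h3 : Real.sqrt 3 ^ 2 = 3 := Real.sq_sqrt (by norm_num)
  nlinarith [h3]

/-- `‖embC x‖² = N(x)` (the quadratic-algebra norm). [folklore] -/
theorem norm_sq_embC (x : K3) : ‖embC x‖ ^ 2 = ((QuadraticAlgebra.norm x : ℚ) : ℝ) := by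
  obtain ⟨a, b⟩ := x
  rw [norm_sq_embC_mk, norm_mk]; push_cast; ring

/-- `embC` is injective. [folklore] -/
theorem embC_injective : Function.Injective embC := embC.toRingHom.injective

/-- **The algebra norm of `K3/ℚ` is the norm form.** [folklore] -/
theorem algebraNorm_eq (x : K3) : Algebra.norm ℚ x = QuadraticAlgebra.norm x := by
  rw [Algebra.norm_apply, ← QuadraticAlgebra.det_toLinearMap_eq_norm]
  congr 1

/-- **`N(span{x}) = ‖embC x‖²`** for an algebraic integer `x ≠ 0` of `K3`. [folklore] -/
theorem absNorm_span_singleton_eq (x : 𝓞 K3) :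
    ((Ideal.absNorm (Ideal.span {x}) : ℕ) : ℝ) = ‖embC (x : K3)‖ ^ 2 := by
  rw [Ideal.absNorm_span_singleton, norm_sq_embC]
  have h1 : ((Algebra.norm ℤ x : ℤ) : ℚ) = QuadraticAlgebra.norm (x : K3) := by
    rw [Algebra.coe_norm_int, algebraNorm_eq]
  have hnn : 0 ≤ QuadraticAlgebra.norm (x : K3) := by
    have := norm_sq_embC (x : K3)
    have h0 : (0 : ℝ) ≤ ‖embC (x : K3)‖ ^ 2 := sq_nonneg _
    rw [this] at h0
    exact_mod_cast h0
  have hpos : (0 : ℤ) ≤ Algebra.norm ℤ x := by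
    have : (0 : ℚ) ≤ (Algebra.norm ℤ x : ℚ) := by rw [h1]; exact hnn
    exact_mod_cast this
  have h3 : (((Algebra.norm ℤ x).natAbs : ℕ) : ℝ) = ((Algebra.norm ℤ x : ℤ) : ℝ) := by
    rw [Nat.cast_natAbs, abs_of_nonneg hpos]
  rw [h3]
  have h4 : ((Algebra.norm ℤ x : ℤ) : ℝ) = ((QuadraticAlgebra.norm (x : K3) : ℚ) : ℝ) := by
    rw [← h1]; push_cast; rfl
  rw [h4]

/-! ### Primary generators: the unique generator `≡ 1 (mod 3)` of an ideal prime to `3` -/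

/-- `ζ₃` as an algebraic integer is a primitive cube root of unity. [folklore] -/
theorem hζ : IsPrimitiveRoot (zetaInt : 𝓞 K3) 3 := isPrimitiveRoot_zeta.toInteger_isPrimitiveRoot

/-- `𝓞 K3` has no real embedding... rather `K3` has none. [folklore] -/
theorem isEmpty_ringHom_real_K3 : IsEmpty (K3 →+* ℝ) := isEmpty_ringHom_real hζ

/-- The ideal `(3)`. [folklore] -/
abbrev three : Ideal (𝓞 K3) := Ideal.span {(3 : 𝓞 K3)}

/-- Existence and uniqueness of the primary generator of an ideal prime to `3`.
[cite: IrelandRosen1990, Ch. 9 §3 Prop. 9.3.5] -/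
theorem existsUnique_primary {I : Ideal (𝓞 K3)} (hI : IsCoprime I three) :
    ∃! α : 𝓞 K3, Ideal.span {α} = I ∧ α - 1 ∈ three := by
  obtain ⟨g, hg⟩ := (IsPrincipalIdealRing.principal I).principal
  have hgI : Ideal.span {g} = I := by rw [hg]
  have hcop : IsCoprime (Ideal.span {g}) three := by rwa [hgI]
  obtain ⟨u, hu⟩ := exists_units_mul_sub_one_mem_span_three hζ g hcop
  refine ⟨u * g, ⟨?_, hu⟩, ?_⟩
  · rw [← hgI]
    exact Ideal.span_singleton_eq_span_singleton.mpr ⟨u⁻¹, by simp [mul_comm]⟩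
  · rintro β ⟨hβ, hβ1⟩
    refine eq_of_span_eq_of_sub_one_mem_span_three hζ ?_ ?_ hβ1 hu
    · rw [hβ, ← hgI]
      exact (Ideal.span_singleton_eq_span_singleton.mpr ⟨u⁻¹, by simp [mul_comm]⟩).symm
    · rwa [hβ]

open Classical in
/-- **The primary generator** `primGen I` of an ideal `I` prime to `3` (junk value `1` otherwise).
[cite: IrelandRosen1990, Ch. 9 §3 Prop. 9.3.5] -/
def primGen (I : Ideal (𝓞 K3)) : 𝓞 K3 :=
  if hI : IsCoprime I three then (existsUnique_primary hI).choose else 1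

/-- `span {primGen I} = I`. [folklore] -/
theorem span_primGen {I : Ideal (𝓞 K3)} (hI : IsCoprime I three) : Ideal.span {primGen I} = I := by
  rw [primGen, dif_pos hI]; exact (existsUnique_primary hI).choose_spec.1.1

/-- `primGen I ≡ 1 (mod 3)`. [folklore] -/
theorem primGen_sub_one_mem {I : Ideal (𝓞 K3)} (hI : IsCoprime I three) : primGen I - 1 ∈ three := by
  rw [primGen, dif_pos hI]; exact (existsUnique_primary hI).choose_spec.1.2

/-- Characterisation: a generator `≡ 1 (mod 3)` IS the primary generator. [folklore] -/
theorem primGen_eq_of {I : Ideal (𝓞 K3)} (hI : IsCoprime I three) {α : 𝓞 K3}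
    (hα : Ideal.span {α} = I) (hα1 : α - 1 ∈ three) : primGen I = α := by
  have hu := (existsUnique_primary hI).unique ⟨span_primGen hI, primGen_sub_one_mem hI⟩ ⟨hα, hα1⟩
  exact hu

/-- An element `≡ 1 (mod 3)` generates an ideal prime to `3`. [folklore] -/
theorem isCoprime_three_of_sub_one_mem {α : 𝓞 K3} (hα1 : α - 1 ∈ three) :
    IsCoprime (Ideal.span {α}) three := by
  rw [Ideal.isCoprime_span_singleton_iff]
  obtain ⟨c, hc⟩ := Ideal.mem_span_singleton'.mp hα1
  exact ⟨1, -c, by linear_combination (-1 : 𝓞 K3) * hc⟩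

/-- `primGen (span{α}) = α` for `α ≡ 1 (mod 3)`. [folklore] -/
theorem primGen_span_singleton {α : 𝓞 K3} (hα1 : α - 1 ∈ three) : primGen (Ideal.span {α}) = α :=
  primGen_eq_of (isCoprime_three_of_sub_one_mem hα1) rfl hα1

/-- `primGen ⊤ = 1`. [folklore] -/
theorem primGen_top : primGen (⊤ : Ideal (𝓞 K3)) = 1 := by
  have h := primGen_span_singleton (α := (1 : 𝓞 K3)) (by simp)
  rwa [Ideal.span_singleton_one] at h

/-- `primGen I ≠ 0` for `I ≠ 0` prime to `3`. [folklore] -/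
theorem primGen_ne_zero {I : Ideal (𝓞 K3)} (hI : IsCoprime I three) (hI0 : I ≠ ⊥) : primGen I ≠ 0 := by
  intro h
  apply hI0
  rw [← span_primGen hI, h, Ideal.span_singleton_eq_bot]

/-- **Multiplicativity of primary generators.** [folklore] -/
theorem primGen_mul {I J : Ideal (𝓞 K3)} (hI : IsCoprime I three) (hJ : IsCoprime J three) :
    primGen (I * J) = primGen I * primGen J := by
  have hIJ : IsCoprime (I * J) three := IsCoprime.mul_left hI hJ
  refine primGen_eq_of hIJ ?_ ?_
  · rw [← Ideal.span_singleton_mul_span_singleton, span_primGen hI, span_primGen hJ]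
  · have h1 := primGen_sub_one_mem hI
    have h2 := primGen_sub_one_mem hJ
    have e : primGen I * primGen J - 1 = (primGen I - 1) * primGen J + (primGen J - 1) := by ring
    rw [e]
    exact three.add_mem (three.mul_mem_right _ h1) h2

/-! ### The cubic-symbol part `ψ_D` (Artin symbol of the Kummer character of `K3(∛D)/K3`) -/

section Symbol

variable (D : 𝓞 K3)

open Classical in
/-- The local values `v ↦ kummerChar(Frob_v) ∈ ℂˣ` (`= e(χ_v(D))` for `v ∤ 3D`), or `1` when `D`
is a cube in `K3`. [cite: IrelandRosen1990, Ch. 9 §3 Prop. 9.3.3] -/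
def psiLoc : HeightOneSpectrum (𝓞 K3) → ℂˣ :=
  if hD : ∀ b : K3, b ^ 3 ≠ (D : K3) then
    haveI := isGalois_kummerField hζ hD
    fun v ↦ kummerChar hζ hD (embC.toRingHom) (galFrob K3 (kummerField D) v)
  else fun _ ↦ 1

/-- The local values are cube roots of unity. [folklore] -/
theorem psiLoc_pow_three (v : HeightOneSpectrum (𝓞 K3)) : psiLoc D v ^ 3 = 1 := by
  unfold psiLoc
  split_ifs with hD
  · exact kummerChar_pow_three hζ hD _ _
  · simp

/-- **The symbol** `ψ_D(I) = ∏_v ψ_D(v)^{ord_v I} ∈ ℂˣ` (the Artin symbol of the local values).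
[cite: IrelandRosen1990, Ch. 9 §3 Theorem 1] -/
def psi (I : Ideal (𝓞 K3)) : ℂˣ := LFunctions.AbelianDensity.artinSymbol (psiLoc D) I

/-- `ψ_D(I)³ = 1`. [folklore] -/
theorem psi_pow_three (I : Ideal (𝓞 K3)) : psi D I ^ 3 = 1 :=
  artinSymbol_pow_three_eq_one (psiLoc_pow_three D) I

/-- `‖ψ_D(I)‖ = 1`. [folklore] -/
theorem norm_psi (I : Ideal (𝓞 K3)) : ‖((psi D I : ℂˣ) : ℂ)‖ = 1 := by
  have h : ((psi D I : ℂˣ) : ℂ) ^ 3 = 1 := by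
    rw [← Units.val_pow_eq_pow_val, psi_pow_three, Units.val_one]
  have h' : ‖((psi D I : ℂˣ) : ℂ)‖ ^ 3 = 1 := by rw [← norm_pow, h, norm_one]
  exact (pow_eq_one_iff_of_nonneg (norm_nonneg _) (by norm_num)).mp h'

/-- `ψ_D` is multiplicative on nonzero ideals. [folklore] -/
theorem psi_mul {I J : Ideal (𝓞 K3)} (hI : I ≠ ⊥) (hJ : J ≠ ⊥) : psi D (I * J) = psi D I * psi D J :=
  LFunctions.AbelianDensity.artinSymbol_mul _ hI hJ

/-- `ψ_D(⊤) = 1`. [folklore] -/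
theorem psi_top : psi D ⊤ = 1 := by
  have h := psi_mul D (I := ⊤) (J := ⊤) (by simp) (by simp)
  rw [Ideal.top_mul] at h
  -- `x = x * x` in a group forces `x = 1`
  have h2 : psi D ⊤ * 1 = psi D ⊤ * psi D ⊤ := by rw [mul_one]; exact h
  exact (mul_left_cancel h2).symm

/-- The Artin symbol of the trivial local data is trivial. [folklore] -/
theorem artinSymbol_const_one (I : Ideal (𝓞 K3)) :
    LFunctions.AbelianDensity.artinSymbol (fun _ : HeightOneSpectrum (𝓞 K3) ↦ (1 : ℂˣ)) I = 1 := by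
  unfold LFunctions.AbelianDensity.artinSymbol; simp

/-- **Periodicity of `ψ_D` modulo `9D`** on principal ideals with generator prime to `3D`
(`KummerCubicCharacterPeriodicity.artinSymbol_kummerChar_eq_of_sub_mem_span`).
[cite: IrelandRosen1990, Ch. 9 §3 Theorem 1] -/
theorem psi_span_eq_of_sub_mem {b c : 𝓞 K3} (hb : b ≠ 0) (hc : c ≠ 0)
    (hcop : IsCoprime (Ideal.span {c}) (Ideal.span {3 * D})) (hbc : b - c ∈ Ideal.span {9 * D}) :
    psi D (Ideal.span {b}) = psi D (Ideal.span {c}) := by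
  unfold psi psiLoc
  split_ifs with hD
  · haveI := isGalois_kummerField hζ hD
    exact artinSymbol_kummerChar_eq_of_sub_mem_span hζ hD _ hb hc hcop hbc
  · rw [artinSymbol_const_one, artinSymbol_const_one]

end Symbol


/-! ### The Grössencharacter `ν_{D,r,m}(I) = ψ_D(I)^r (α_I/|α_I|)^m` -/

section Nu

open PlaneLattice

variable (D : 𝓞 K3) (r m : ℕ)

/-- Admissible ideals: nonzero and prime to `3D`. [folklore] -/
def Adm (I : Ideal (𝓞 K3)) : Prop := I ≠ ⊥ ∧ IsCoprime I (Ideal.span {3 * D})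

/-- Coprime to a smaller ideal implies coprime to a larger one. [folklore] -/
theorem isCoprime_of_le {I J J' : Ideal (𝓞 K3)} (h : IsCoprime I J) (hle : J ≤ J') : IsCoprime I J' := by
  rw [Ideal.isCoprime_iff_sup_eq] at h ⊢
  exact top_le_iff.mp (h ▸ sup_le_sup_left hle I)

/-- `span{3D} ≤ (3)`. [folklore] -/
theorem span_three_mul_le : Ideal.span {3 * D} ≤ three :=
  Ideal.span_singleton_le_span_singleton.mpr (dvd_mul_right 3 D)

variable {D} in
/-- Admissible ideals are prime to `3`. [folklore] -/
theorem Adm.coprime_three {I : Ideal (𝓞 K3)} (h : Adm D I) : IsCoprime I three :=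
  isCoprime_of_le h.2 (span_three_mul_le D)

/-- Admissibility of a product. [folklore] -/
theorem adm_mul_iff {I J : Ideal (𝓞 K3)} : Adm D (I * J) ↔ Adm D I ∧ Adm D J := by
  simp only [Adm, Ne, Ideal.mul_eq_bot, not_or, IsCoprime.mul_left_iff]
  tauto

/-- `⊤` is admissible. [folklore] -/
theorem adm_top : Adm D ⊤ := ⟨top_ne_bot, by rw [Ideal.isCoprime_iff_sup_eq, top_sup_eq]⟩

open Classical in
/-- The values of `ν_{D,r,m}`. [cite: HeckeMathZ1920, §6] -/
def nuFun (I : Ideal (𝓞 K3)) : ℂ :=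
  if Adm D I then ((psi D I : ℂˣ) : ℂ) ^ r * sectorWeight m (embC (primGen I : K3)) else 0

/-- `sectorWeight` is multiplicative on nonzero arguments. [folklore] -/
theorem sectorWeight_mul_of_ne_zero (m : ℕ) {z z' : ℂ} (hz : z ≠ 0) (hz' : z' ≠ 0) :
    sectorWeight m (z * z') = sectorWeight m z * sectorWeight m z' := by
  unfold sectorWeight
  rw [norm_mul, Complex.ofReal_mul, ← mul_pow]
  congr 1
  have h1 : (‖z‖ : ℂ) ≠ 0 := by exact_mod_cast norm_ne_zero_iff.mpr hz
  have h2 : (‖z'‖ : ℂ) ≠ 0 := by exact_mod_cast norm_ne_zero_iff.mpr hz'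
  field_simp

/-- `sectorWeight m 1 = 1`. [folklore] -/
theorem sectorWeight_one (m : ℕ) : sectorWeight m 1 = 1 := by
  simp [sectorWeight]

/-- `embC` of a nonzero integer is nonzero. [folklore] -/
theorem embC_ne_zero {x : 𝓞 K3} (hx : x ≠ 0) : embC (x : K3) ≠ 0 := by
  intro h
  apply hx
  have h' : (x : K3) = 0 := embC_injective (h.trans (map_zero embC).symm)
  exact RingOfIntegers.ext (by simp [h'])

/-- **The Grössencharacter `ν_{D,r,m}`** of `K3 = ℚ(ζ₃)` as a homomorphism on ideals:
`ν(I) = ψ_D(I)^r · (e(α_I)/|e(α_I)|)^m` for `I ≠ 0` prime to `3D` with primary generator `α_I`,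
and `ν(I) = 0` otherwise. [cite: HeckeMathZ1920, §6] -/
def grossenNu : Ideal (𝓞 K3) →*₀ ℂ where
  toFun := nuFun D r m
  map_zero' := by
    simp only [nuFun, Adm, Ideal.zero_eq_bot, ne_eq, not_true_eq_false, false_and, if_false]
  map_one' := by
    simp only [nuFun, Ideal.one_eq_top, adm_top, if_true, psi_top, Units.val_one, one_pow, one_mul,
      primGen_top, map_one, sectorWeight_one]
  map_mul' I J := by
    classical
    simp only [nuFun]
    by_cases hI : Adm D I
    · by_cases hJ : Adm D J
      · have hIJ : Adm D (I * J) := (adm_mul_iff D).mpr ⟨hI, hJ⟩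
        rw [if_pos hIJ, if_pos hI, if_pos hJ, psi_mul D hI.1 hJ.1, primGen_mul hI.coprime_three hJ.coprime_three,
          Units.val_mul, mul_pow]
        push_cast
        rw [map_mul, sectorWeight_mul_of_ne_zero m (embC_ne_zero (primGen_ne_zero hI.coprime_three hI.1))
          (embC_ne_zero (primGen_ne_zero hJ.coprime_three hJ.1))]
        ring
      · have hIJ : ¬ Adm D (I * J) := fun h ↦ hJ ((adm_mul_iff D).mp h).2
        rw [if_neg hIJ, if_neg hJ, mul_zero]
    · have hIJ : ¬ Adm D (I * J) := fun h ↦ hI ((adm_mul_iff D).mp h).1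
      rw [if_neg hIJ, if_neg hI, zero_mul]

open Classical in
/-- Unfolding `grossenNu`. [folklore] -/
theorem grossenNu_apply (I : Ideal (𝓞 K3)) :
    grossenNu D r m I = if Adm D I then ((psi D I : ℂˣ) : ℂ) ^ r * sectorWeight m (embC (primGen I : K3)) else 0 :=
  rfl

/-- **`‖ν(I)‖ ≤ 1`.** [folklore] -/
theorem norm_grossenNu_le (I : Ideal (𝓞 K3)) : ‖grossenNu D r m I‖ ≤ 1 := by
  rw [grossenNu_apply]
  split_ifs
  · rw [norm_mul, norm_pow, norm_psi, one_pow, one_mul]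
    exact norm_sectorWeight_le m _
  · simp

/-- **The square**: `ν_{D,r,m}(I)² = ν_{D,2r,2m}(I)`. [folklore] -/
theorem grossenNu_sq (I : Ideal (𝓞 K3)) : grossenNu D r m I ^ 2 = grossenNu D (2 * r) (2 * m) I := by
  rw [grossenNu_apply, grossenNu_apply]
  split_ifs
  · unfold sectorWeight
    ring
  · simp

/-- The value on an admissible principal ideal with primary generator. [folklore] -/
theorem grossenNu_span_of_primary {α : 𝓞 K3} (hα1 : α - 1 ∈ three) (hadm : Adm D (Ideal.span {α})) :
    grossenNu D r m (Ideal.span {α}) = ((psi D (Ideal.span {α}) : ℂˣ) : ℂ) ^ r * sectorWeight m (embC (α : K3)) := by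
  rw [grossenNu_apply, if_pos hadm, primGen_span_singleton hα1]

end Nu

/-! ### Partial sums I: from the Dirichlet coefficients to primary elements -/

section Sums

open PlaneLattice LFunctions.NumberField

variable (D : 𝓞 K3) (r m : ℕ)

/-- The non-zero ideals of norm `≤ N`. [folklore] -/
def idealsUpTo (N : ℕ) : Finset (Ideal (𝓞 K3)) := (Finset.Icc 1 N).biUnion (fun n ↦ idealsOfNorm K3 n)

/-- Membership in `idealsUpTo N`: `I ≠ 0` and `N(I) ≤ N`. [folklore] -/
theorem mem_idealsUpTo {N : ℕ} {I : Ideal (𝓞 K3)} : I ∈ idealsUpTo N ↔ I ≠ ⊥ ∧ Ideal.absNorm I ≤ N := by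
  rw [idealsUpTo, Finset.mem_biUnion]
  constructor
  · rintro ⟨n, hn, hI⟩
    rw [mem_idealsOfNorm] at hI
    rw [Finset.mem_Icc] at hn
    refine ⟨fun h ↦ ?_, hI ▸ hn.2⟩
    rw [h, Ideal.absNorm_bot] at hI; omega
  · rintro ⟨hI, hN⟩
    refine ⟨Ideal.absNorm I, Finset.mem_Icc.2 ⟨Nat.one_le_iff_ne_zero.2 ?_, hN⟩, by rw [mem_idealsOfNorm]⟩
    exact Ideal.absNorm_eq_zero_iff.not.2 hI

/-- **`Σ_{n ≤ N} twistCount ν n = Σ_{0 < N(I) ≤ N} ν(I)`.** [folklore] -/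
theorem sum_Icc_twistCount_eq (ν : Ideal (𝓞 K3) →*₀ ℂ) (N : ℕ) :
    ∑ n ∈ Finset.Icc 1 N, twistCount K3 ν n = ∑ I ∈ idealsUpTo N, ν I := by
  unfold twistCount
  rw [idealsUpTo, Finset.sum_biUnion]
  intro a _ b _ hab
  simp only [Function.onFun]
  rw [Finset.disjoint_left]
  intro I h1 h2
  rw [mem_idealsOfNorm] at h1 h2
  exact hab (h1.symm.trans h2)

open Classical in
/-- The box of algebraic integers `a + bζ`, `|a|, |b| ≤ B`. [folklore] -/
def intBox (B : ℕ) : Finset (𝓞 K3) :=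
  ((Finset.Icc (-(B : ℤ)) B) ×ˢ (Finset.Icc (-(B : ℤ)) B)).image (fun p ↦ mkInt p.1 p.2)

/-- Coordinates are bounded by the norm form: `4(a² − ab + b²) = (2a − b)² + 3b²`. [folklore] -/
theorem abs_le_of_normForm_le {a b : ℤ} {N : ℕ} (h : a ^ 2 - a * b + b ^ 2 ≤ N) :
    |a| ≤ N + 1 ∧ |b| ≤ N + 1 := by
  have hb : b ^ 2 ≤ (N + 1 : ℤ) ^ 2 := by nlinarith [sq_nonneg (2 * a - b)]
  have ha : a ^ 2 ≤ (N + 1 : ℤ) ^ 2 := by nlinarith [sq_nonneg (2 * b - a)]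
  constructor
  · exact abs_le_of_sq_le_sq' ha (by positivity) |> fun h ↦ abs_le.mpr h
  · exact abs_le_of_sq_le_sq' hb (by positivity) |> fun h ↦ abs_le.mpr h

open Classical in
/-- An integer of norm `≤ N` lies in the box of size `N + 1`. [folklore] -/
theorem mem_intBox_of_absNorm_le {α : 𝓞 K3} {N : ℕ} (h : Ideal.absNorm (Ideal.span {α}) ≤ N) :
    α ∈ intBox (N + 1) := by
  obtain ⟨a, b, rfl⟩ := exists_eq_mkInt α
  have hn : ((Ideal.absNorm (Ideal.span {mkInt a b}) : ℕ) : ℝ) = (a : ℝ) ^ 2 - a * b + (b : ℝ) ^ 2 := by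
    rw [absNorm_span_singleton_eq, coe_mkInt, norm_sq_embC_mk]; push_cast; ring
  have h' : (a : ℤ) ^ 2 - a * b + b ^ 2 ≤ N := by
    have : ((Ideal.absNorm (Ideal.span {mkInt a b}) : ℕ) : ℝ) ≤ N := by exact_mod_cast h
    rw [hn] at this
    exact_mod_cast this
  obtain ⟨ha, hb⟩ := abs_le_of_normForm_le h'
  rw [intBox, Finset.mem_image]
  refine ⟨(a, b), ?_, rfl⟩
  rw [Finset.mem_product, Finset.mem_Icc, Finset.mem_Icc]
  push_cast
  exact ⟨abs_le.mp ha, abs_le.mp hb⟩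

open Classical in
/-- The primary admissible elements of norm `≤ N`. [folklore] -/
def primElts (N : ℕ) : Finset (𝓞 K3) :=
  (intBox (N + 1)).filter (fun α ↦ α - 1 ∈ three ∧ Adm D (Ideal.span {α}) ∧ Ideal.absNorm (Ideal.span {α}) ≤ N)

open Classical in
/-- Membership in `primElts`. [folklore] -/
theorem mem_primElts {N : ℕ} {α : 𝓞 K3} :
    α ∈ primElts D N ↔ α - 1 ∈ three ∧ Adm D (Ideal.span {α}) ∧ Ideal.absNorm (Ideal.span {α}) ≤ N := by
  rw [primElts, Finset.mem_filter]
  exact ⟨fun h ↦ h.2, fun h ↦ ⟨mem_intBox_of_absNorm_le h.2.2, h⟩⟩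

open Classical in
/-- **From ideals to primary elements**: `Σ_{0<N(I)≤N} ν(I) = Σ_{α primary admissible, N(α)≤N} ν((α))`
(`I ↦ α_I` is a bijection onto the primary admissible elements; inadmissible ideals contribute `0`).
[folklore] -/
theorem sum_idealsUpTo_eq_sum_primElts (N : ℕ) :
    ∑ I ∈ idealsUpTo N, grossenNu D r m I = ∑ α ∈ primElts D N, grossenNu D r m (Ideal.span {α}) := by
  -- drop the inadmissible ideals
  rw [← Finset.sum_filter_add_sum_filter_not (idealsUpTo N) (Adm D)]
  have hzero : ∑ I ∈ (idealsUpTo N).filter (fun I ↦ ¬ Adm D I), grossenNu D r m I = 0 := by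
    refine Finset.sum_eq_zero fun I hI ↦ ?_
    rw [Finset.mem_filter] at hI
    rw [grossenNu_apply, if_neg hI.2]
  rw [hzero, add_zero]
  -- bijection `I ↦ primGen I`
  refine Finset.sum_nbij' (fun I ↦ primGen I) (fun α ↦ Ideal.span {α}) ?_ ?_ ?_ ?_ ?_
  · intro I hI
    rw [Finset.mem_filter, mem_idealsUpTo] at hI
    obtain ⟨⟨hI0, hIN⟩, hadm⟩ := hI
    rw [mem_primElts, span_primGen hadm.coprime_three]
    exact ⟨primGen_sub_one_mem hadm.coprime_three, hadm, hIN⟩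
  · intro α hα
    rw [mem_primElts] at hα
    rw [Finset.mem_filter, mem_idealsUpTo]
    exact ⟨⟨hα.2.1.1, hα.2.2⟩, hα.2.1⟩
  · intro I hI
    rw [Finset.mem_filter] at hI
    exact span_primGen hI.2.coprime_three
  · intro α hα
    rw [mem_primElts] at hα
    exact primGen_span_singleton hα.1
  · intro I hI
    rw [Finset.mem_filter] at hI
    rw [span_primGen hI.2.coprime_three]

/-! ### Partial sums II: congruence classes modulo `9D` are lattice cosets; the bound -/

/-- The absolute constant of the hexagonal lattice in `norm_sum_sectorWeight_le`. [folklore] -/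
def Cw : ℝ := 16 * (4 * (1 + ‖w‖) / w.im + 1) * (4 * (1 + ‖w‖) + 1)

/-- `0 < Cw`. [folklore] -/
theorem Cw_pos : 0 < Cw := by
  unfold Cw
  have := w_im_pos
  positivity

variable {D}

/-- `3` is not a unit of `𝓞 K3`. [folklore] -/
theorem not_isUnit_three_K3 : ¬ IsUnit (3 : 𝓞 K3) := not_isUnit_three hζ

/-- An admissible element is prime to `9D` in the sense that it is not in `span{3D}`; in particular
an element congruent to it modulo `9D` is nonzero. [folklore] -/
theorem ne_zero_of_sub_mem {β₀ α : 𝓞 K3} (hβ : IsCoprime (Ideal.span {β₀}) (Ideal.span {3 * D}))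
    (h : α - β₀ ∈ Ideal.span {9 * D}) : α ≠ 0 := by
  rintro rfl
  rw [zero_sub, Ideal.neg_mem_iff] at h
  have h3 : β₀ ∈ Ideal.span {3 * D} :=
    Ideal.span_singleton_le_span_singleton.mpr ⟨3, by ring⟩ h
  have htop : Ideal.span {3 * D} = ⊤ := by
    have := Ideal.isCoprime_iff_sup_eq.mp hβ
    rwa [sup_eq_right.mpr ((Ideal.span_singleton_le_iff_mem _).mpr h3)] at this
  rw [Ideal.span_singleton_eq_top] at htop
  exact not_isUnit_three_K3 (isUnit_of_mul_isUnit_left htop)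

/-- Coprimality to `span{3D}` passes along congruences modulo `9D`. [folklore] -/
theorem isCoprime_of_sub_mem {β₀ α : 𝓞 K3} (hβ : IsCoprime (Ideal.span {β₀}) (Ideal.span {3 * D}))
    (h : α - β₀ ∈ Ideal.span {9 * D}) : IsCoprime (Ideal.span {α}) (Ideal.span {3 * D}) := by
  have h3 : α - β₀ ∈ Ideal.span {3 * D} :=
    Ideal.span_singleton_le_span_singleton.mpr ⟨3, by ring⟩ h
  rw [Ideal.isCoprime_iff_exists] at hβ ⊢
  obtain ⟨i, hi, j, hj, hij⟩ := hβ
  obtain ⟨a, rfl⟩ := Ideal.mem_span_singleton'.mp hi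
  refine ⟨a * α, Ideal.mem_span_singleton'.mpr ⟨a, rfl⟩, j - a * (α - β₀), ?_, by linear_combination hij⟩
  exact (Ideal.span {3 * D}).sub_mem hj (Ideal.mul_mem_left _ _ h3)

/-- The parametrisation of a congruence class: `p ↦ β₀ + 9D (p₁ + p₂ ζ)`. [folklore] -/
def classPt (D β₀ : 𝓞 K3) (p : ℤ × ℤ) : 𝓞 K3 := β₀ + 9 * D * mkInt p.1 p.2

/-- `classPt` is injective (`D ≠ 0`). [folklore] -/
theorem classPt_injective (hD0 : D ≠ 0) (β₀ : 𝓞 K3) : Function.Injective (classPt D β₀) := by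
  intro p q h
  simp only [classPt, add_right_inj] at h
  have h9' : (9 : 𝓞 K3) ≠ 0 := by
    have : ((9 : ℕ) : 𝓞 K3) ≠ 0 := Nat.cast_ne_zero.mpr (by norm_num)
    exact_mod_cast this
  have h9 : (9 * D : 𝓞 K3) ≠ 0 := mul_ne_zero h9' hD0
  have := mul_left_cancel₀ h9 h
  exact Prod.ext (mkInt_inj.mp this).1 (mkInt_inj.mp this).2

/-- **The embedding of a congruence class is a lattice coset**:
`e(β₀ + 9D(a + bζ)) = e(β₀) + e(9D)(a + b w)`. [folklore] -/
theorem embC_classPt (β₀ : 𝓞 K3) (p : ℤ × ℤ) :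
    embC (classPt D β₀ p : K3) = cosetPt (embC (β₀ : K3)) (embC ((9 * D : 𝓞 K3) : K3)) w p := by
  simp only [classPt, cosetPt]
  push_cast
  rw [map_add, map_mul, embC_mkInt]

/-- The box of indices for the class of `β₀` at radius `ρ`. [folklore] -/
def idxBox (β c : ℂ) (ρ : ℝ) : Finset (ℤ × ℤ) :=
  let B : ℕ := ⌈2 * (ρ / ‖c‖ + ‖β / c‖)⌉₊
  (Finset.Icc (-(B : ℤ)) B) ×ˢ (Finset.Icc (-(B : ℤ)) B)

/-- **The index box is complete**: every `p` with `‖cosetPt β c w p‖ ≤ ρ` lies in it. [folklore] -/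
theorem mem_idxBox {β c : ℂ} (hc : c ≠ 0) {ρ : ℝ} (hρ : 0 ≤ ρ) {p : ℤ × ℤ}
    (hp : ‖cosetPt β c w p‖ ≤ ρ) : p ∈ idxBox β c ρ := by
  have hc0 : 0 < ‖c‖ := norm_pos_iff.mpr hc
  set M := ρ / ‖c‖ + ‖β / c‖ with hM
  have hM0 : 0 ≤ M := by positivity
  have h2 := abs_snd_mul_im_add_le (τ := w) hc hp
  have h1 := abs_fst_add_le (τ := w) hc hp
  rw [w_im] at h2
  rw [w_re] at h1
  have him : |(β / c).im| ≤ ‖β / c‖ := Complex.abs_im_le_norm _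
  have hre : |(β / c).re| ≤ ‖β / c‖ := Complex.abs_re_le_norm _
  have h3 : (1 : ℝ) ≤ Real.sqrt 3 := Real.one_le_sqrt.mpr (by norm_num)
  -- `|p.2| ≤ 2M`
  have hp2 : |(p.2 : ℝ)| ≤ 2 * M := by
    have : |(p.2 : ℝ) * (Real.sqrt 3 / 2)| ≤ M := by
      calc |(p.2 : ℝ) * (Real.sqrt 3 / 2)| = |((p.2 : ℝ) * (Real.sqrt 3 / 2) + (β / c).im) - (β / c).im| := by
            ring_nf
        _ ≤ |(p.2 : ℝ) * (Real.sqrt 3 / 2) + (β / c).im| + |(β / c).im| := abs_sub _ _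
        _ ≤ ρ / ‖c‖ + ‖β / c‖ := add_le_add h2 him
    rw [abs_mul, abs_of_pos (by positivity : (0 : ℝ) < Real.sqrt 3 / 2)] at this
    nlinarith [abs_nonneg (p.2 : ℝ)]
  -- `|p.1| ≤ 2M`
  have hp1 : |(p.1 : ℝ)| ≤ 2 * M := by
    have : |(p.1 : ℝ)| ≤ |(p.1 : ℝ) + p.2 * (-1 / 2) + (β / c).re| + |(p.2 : ℝ)| / 2 + |(β / c).re| := by
      have e : (p.1 : ℝ) = ((p.1 : ℝ) + p.2 * (-1 / 2) + (β / c).re) + (p.2 : ℝ) / 2 - (β / c).re := by ring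
      calc |(p.1 : ℝ)| = |((p.1 : ℝ) + p.2 * (-1 / 2) + (β / c).re) + (p.2 : ℝ) / 2 - (β / c).re| := by rw [← e]
        _ ≤ |((p.1 : ℝ) + p.2 * (-1 / 2) + (β / c).re) + (p.2 : ℝ) / 2| + |(β / c).re| := abs_sub _ _
        _ ≤ |(p.1 : ℝ) + p.2 * (-1 / 2) + (β / c).re| + |(p.2 : ℝ) / 2| + |(β / c).re| := by
            gcongr; exact abs_add_le _ _
        _ = _ := by rw [abs_div, abs_two]
    linarith
  have hB : 2 * M ≤ (⌈2 * (ρ / ‖c‖ + ‖β / c‖)⌉₊ : ℝ) := by rw [← hM]; exact Nat.le_ceil _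
  simp only [idxBox, Finset.mem_product, Finset.mem_Icc]
  have k1 := abs_le.mp (hp1.trans hB)
  have k2 := abs_le.mp (hp2.trans hB)
  refine ⟨⟨?_, ?_⟩, ?_, ?_⟩ <;>
    first | exact_mod_cast k1.1 | exact_mod_cast k1.2 | exact_mod_cast k2.1 | exact_mod_cast k2.2

/-- `‖e(α)‖ ≤ √N` iff `N(α) ≤ N` (real form). [folklore] -/
theorem norm_embC_le_sqrt_iff (α : 𝓞 K3) (N : ℕ) :
    ‖embC (α : K3)‖ ≤ Real.sqrt N ↔ Ideal.absNorm (Ideal.span {α}) ≤ N := by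
  have h := absNorm_span_singleton_eq α
  constructor
  · intro hle
    have h2 : ‖embC (α : K3)‖ ^ 2 ≤ (N : ℝ) := by
      calc ‖embC (α : K3)‖ ^ 2 ≤ Real.sqrt N ^ 2 := by gcongr
        _ = (N : ℝ) := Real.sq_sqrt (Nat.cast_nonneg N)
    rw [← h] at h2
    exact_mod_cast h2
  · intro hle
    have h2 : ((Ideal.absNorm (Ideal.span {α}) : ℕ) : ℝ) ≤ N := by exact_mod_cast hle
    rw [h] at h2
    calc ‖embC (α : K3)‖ = Real.sqrt (‖embC (α : K3)‖ ^ 2) := (Real.sqrt_sq (norm_nonneg _)).symm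
      _ ≤ Real.sqrt N := Real.sqrt_le_sqrt h2

/-- `9 D t ∈ (3)`. [folklore] -/
theorem nine_mul_mem_three (t : 𝓞 K3) : 9 * D * t ∈ three :=
  Ideal.mem_span_singleton'.mpr ⟨3 * D * t, by ring⟩

open Classical in
/-- **A congruence class of primary admissible elements of norm `≤ N` is the image of the filtered
index box** under `p ↦ β₀ + 9D(p₁ + p₂ζ)`. [folklore] -/
theorem fibre_eq_image (hD0 : D ≠ 0) {N : ℕ} {β₀ : 𝓞 K3} (hβ₀ : β₀ ∈ primElts D N) :
    (primElts D N).filter (fun α ↦ α - β₀ ∈ Ideal.span {9 * D}) =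
      ((idxBox (embC (β₀ : K3)) (embC ((9 * D : 𝓞 K3) : K3))
          (Real.sqrt N + (‖embC ((9 * D : 𝓞 K3) : K3)‖ + ‖embC ((9 * D : 𝓞 K3) : K3) * w‖))).filter
        (fun p ↦ ‖cosetPt (embC (β₀ : K3)) (embC ((9 * D : 𝓞 K3) : K3)) w p‖ ≤ Real.sqrt N)).image
        (classPt D β₀) := by
  set β : ℂ := embC (β₀ : K3) with hβ
  set c : ℂ := embC ((9 * D : 𝓞 K3) : K3) with hc
  have h9D : (9 * D : 𝓞 K3) ≠ 0 := by
    refine mul_ne_zero ?_ hD0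
    have : ((9 : ℕ) : 𝓞 K3) ≠ 0 := Nat.cast_ne_zero.mpr (by norm_num)
    exact_mod_cast this
  have hc0 : c ≠ 0 := embC_ne_zero h9D
  rw [mem_primElts] at hβ₀
  obtain ⟨hβ1, hβadm, -⟩ := hβ₀
  ext α
  rw [Finset.mem_filter, Finset.mem_image, mem_primElts]
  constructor
  · rintro ⟨⟨hα1, hαadm, hαN⟩, hsub⟩
    obtain ⟨t, ht⟩ := Ideal.mem_span_singleton'.mp hsub
    obtain ⟨a, b, rfl⟩ := exists_eq_mkInt t
    have hαeq : classPt D β₀ (a, b) = α := by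
      simp only [classPt]; linear_combination ht
    refine ⟨(a, b), ?_, hαeq⟩
    rw [Finset.mem_filter]
    have hle : ‖cosetPt β c w (a, b)‖ ≤ Real.sqrt N := by
      rw [hβ, hc, ← embC_classPt, hαeq]
      exact (norm_embC_le_sqrt_iff α N).mpr hαN
    refine ⟨mem_idxBox hc0 (by positivity) (hle.trans ?_), hle⟩
    have : 0 ≤ ‖c‖ + ‖c * w‖ := by positivity
    linarith
  · rintro ⟨p, hp, rfl⟩
    rw [Finset.mem_filter] at hp
    obtain ⟨-, hle⟩ := hp
    have hsub : classPt D β₀ p - β₀ ∈ Ideal.span {9 * D} :=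
      Ideal.mem_span_singleton'.mpr ⟨mkInt p.1 p.2, by simp only [classPt]; ring⟩
    refine ⟨⟨?_, ⟨?_, isCoprime_of_sub_mem hβadm.2 hsub⟩, ?_⟩, hsub⟩
    · have e : classPt D β₀ p - 1 = (β₀ - 1) + 9 * D * mkInt p.1 p.2 := by simp only [classPt]; ring
      rw [e]
      exact three.add_mem hβ1 (nine_mul_mem_three _)
    · rw [Ne, Ideal.span_singleton_eq_bot]
      exact ne_zero_of_sub_mem hβadm.2 hsub
    · rw [← norm_embC_le_sqrt_iff, embC_classPt]
      exact hle

/-- `‖e(9D)‖ ≥ 1` (indeed `≥ 9`) for `D ≠ 0`. [folklore] -/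
theorem one_le_norm_embC_nine_mul (hD0 : D ≠ 0) : 1 ≤ ‖embC ((9 * D : 𝓞 K3) : K3)‖ := by
  have h9D : (9 * D : 𝓞 K3) ≠ 0 := by
    refine mul_ne_zero ?_ hD0
    have : ((9 : ℕ) : 𝓞 K3) ≠ 0 := Nat.cast_ne_zero.mpr (by norm_num)
    exact_mod_cast this
  have h1 : 1 ≤ Ideal.absNorm (Ideal.span {(9 * D : 𝓞 K3)}) := by
    rw [Nat.one_le_iff_ne_zero, Ne, Ideal.absNorm_eq_zero_iff, Ideal.span_singleton_eq_bot]
    exact h9D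
  have h2 : (1 : ℝ) ≤ ‖embC ((9 * D : 𝓞 K3) : K3)‖ ^ 2 := by
    rw [← absNorm_span_singleton_eq]; exact_mod_cast h1
  nlinarith [norm_nonneg (embC ((9 * D : 𝓞 K3) : K3))]

open Classical in
/-- **The bound on one congruence class** (`norm_sum_sectorWeight_le` on the coset
`e(β₀) + e(9D)(ℤ + ℤw)`, radius `√N`): `‖Σ_{α ∈ class} ν((α))‖ ≤ C_w m (√N + 1)(N^{1/4} + 1)`.
[cite: HeckeMathZ1920, §6] -/
theorem norm_sum_fibre_le (hD0 : D ≠ 0) (hm : 1 ≤ m) (N : ℕ) (β₀ : 𝓞 K3) :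
    ‖∑ α ∈ (primElts D N).filter (fun α ↦ α - β₀ ∈ Ideal.span {9 * D}), grossenNu D r m (Ideal.span {α})‖ ≤
      Cw * m * ((Real.sqrt N + 1) * (Real.sqrt (Real.sqrt N) + 1)) := by
  have hRHS : 0 ≤ Cw * m * ((Real.sqrt N + 1) * (Real.sqrt (Real.sqrt N) + 1)) := by
    have := Cw_pos; positivity
  -- empty fibre, or pick a base point IN the fibre
  by_cases hne : ((primElts D N).filter (fun α ↦ α - β₀ ∈ Ideal.span {9 * D})).Nonempty
  swap
  · rw [Finset.not_nonempty_iff_eq_empty.mp hne, Finset.sum_empty, norm_zero]; exact hRHS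
  obtain ⟨β₁, hβ₁⟩ := hne
  rw [Finset.mem_filter] at hβ₁
  obtain ⟨hβ₁P, hβ₁₀⟩ := hβ₁
  -- re-centre the fibre at `β₁`
  have hfib : (primElts D N).filter (fun α ↦ α - β₀ ∈ Ideal.span {9 * D}) =
      (primElts D N).filter (fun α ↦ α - β₁ ∈ Ideal.span {9 * D}) := by
    refine Finset.filter_congr fun α _ ↦ ⟨fun h ↦ ?_, fun h ↦ ?_⟩
    · have e : α - β₁ = (α - β₀) - (β₁ - β₀) := by ring
      rw [e]; exact Ideal.sub_mem _ h hβ₁₀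
    · have e : α - β₀ = (α - β₁) + (β₁ - β₀) := by ring
      rw [e]; exact Ideal.add_mem _ h hβ₁₀
  rw [hfib]
  have hβ₁P' := hβ₁P
  rw [mem_primElts] at hβ₁P'
  obtain ⟨hβ1, hβadm, -⟩ := hβ₁P'
  have hβ0 : β₁ ≠ 0 := fun h ↦ hβadm.1 (by rw [h, Ideal.span_singleton_eq_bot])
  -- the symbol is constant on the fibre
  have hconst : ∀ α ∈ (primElts D N).filter (fun α ↦ α - β₁ ∈ Ideal.span {9 * D}),
      grossenNu D r m (Ideal.span {α}) =
        ((psi D (Ideal.span {β₁}) : ℂˣ) : ℂ) ^ r * sectorWeight m (embC (α : K3)) := by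
    intro α hα
    rw [Finset.mem_filter, mem_primElts] at hα
    obtain ⟨⟨hα1, hαadm, -⟩, hsub⟩ := hα
    have hα0 : α ≠ 0 := fun h ↦ hαadm.1 (by rw [h, Ideal.span_singleton_eq_bot])
    rw [grossenNu_span_of_primary D r m hα1 hαadm, psi_span_eq_of_sub_mem D hα0 hβ0 hβadm.2 hsub]
  rw [Finset.sum_congr rfl hconst, ← Finset.mul_sum, norm_mul, norm_pow, norm_psi, one_pow, one_mul]
  -- the fibre is a lattice coset
  rw [fibre_eq_image hD0 hβ₁P, Finset.sum_image fun p _ q _ h ↦ classPt_injective hD0 β₁ h]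
  simp_rw [embC_classPt]
  have h := norm_sum_sectorWeight_le w_im_pos (one_le_norm_embC_nine_mul hD0) hm (Real.sqrt_nonneg N)
    (embC (β₁ : K3)) (idxBox (embC (β₁ : K3)) (embC ((9 * D : 𝓞 K3) : K3))
      (Real.sqrt N + (‖embC ((9 * D : 𝓞 K3) : K3)‖ + ‖embC ((9 * D : 𝓞 K3) : K3) * w‖)))
    (fun p hp ↦ mem_idxBox (embC_ne_zero ?_) (by positivity) hp)
  · refine h.trans (le_of_eq ?_)
    unfold Cw; ring
  · refine mul_ne_zero ?_ hD0
    have : ((9 : ℕ) : 𝓞 K3) ≠ 0 := Nat.cast_ne_zero.mpr (by norm_num)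
    exact_mod_cast this

/-- `#(𝓞 K3 / 9D) = N(9D)`. [folklore] -/
theorem card_quotient_eq [Fintype (𝓞 K3 ⧸ Ideal.span {(9 * D : 𝓞 K3)})] :
    Fintype.card (𝓞 K3 ⧸ Ideal.span {(9 * D : 𝓞 K3)}) = Ideal.absNorm (Ideal.span {(9 * D : 𝓞 K3)}) := by
  rw [Ideal.absNorm_apply, Submodule.cardQuot_apply, Nat.card_eq_fintype_card]

open Classical in
/-- **Partial sums of `ν_{D,r,m}` (`m ≥ 1`, `D ≠ 0`):**
`‖Σ_{n ≤ N} (Σ_{N(I)=n} ν(I))‖ ≤ N(9D) · C_w · m · (√N + 1)(N^{1/4} + 1)` — grouping the primary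
admissible elements by classes modulo `9D` (on which `ψ_D` is constant) and bounding each class by
the lattice-coset estimate. [cite: HeckeMathZ1920, §6] -/
theorem norm_sum_twistCount_grossenNu_le (hD0 : D ≠ 0) (hm : 1 ≤ m) (N : ℕ) :
    ‖∑ n ∈ Finset.Icc 1 N, twistCount K3 (grossenNu D r m) n‖ ≤
      Ideal.absNorm (Ideal.span {(9 * D : 𝓞 K3)}) * Cw * m *
        ((Real.sqrt N + 1) * (Real.sqrt (Real.sqrt N) + 1)) := by
  have h9D : (9 * D : 𝓞 K3) ≠ 0 := by
    refine mul_ne_zero ?_ hD0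
    have : ((9 : ℕ) : 𝓞 K3) ≠ 0 := Nat.cast_ne_zero.mpr (by norm_num)
    exact_mod_cast this
  haveI : Finite (𝓞 K3 ⧸ Ideal.span {(9 * D : 𝓞 K3)}) := Ideal.finiteQuotientOfFreeOfNeBot _
    (by rw [Ne, Ideal.span_singleton_eq_bot]; exact h9D)
  haveI : Fintype (𝓞 K3 ⧸ Ideal.span {(9 * D : 𝓞 K3)}) := Fintype.ofFinite _
  rw [sum_Icc_twistCount_eq, sum_idealsUpTo_eq_sum_primElts,
    ← Finset.sum_fiberwise (primElts D N) (Ideal.Quotient.mk (Ideal.span {(9 * D : 𝓞 K3)}))]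
  refine (norm_sum_le _ _).trans ?_
  -- each fibre `{α : mk α = q}` is a fibre `{α : α - β₀ ∈ (9D)}` for a representative `β₀` of `q`
  have hfib : ∀ q : 𝓞 K3 ⧸ Ideal.span {(9 * D : 𝓞 K3)},
      ‖∑ α ∈ (primElts D N).filter (fun α ↦ Ideal.Quotient.mk (Ideal.span {(9 * D : 𝓞 K3)}) α = q),
        grossenNu D r m (Ideal.span {α})‖ ≤ Cw * m * ((Real.sqrt N + 1) * (Real.sqrt (Real.sqrt N) + 1)) := by
    intro q
    obtain ⟨β₀, rfl⟩ := Ideal.Quotient.mk_surjective q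
    have e : (primElts D N).filter (fun α ↦ Ideal.Quotient.mk (Ideal.span {(9 * D : 𝓞 K3)}) α =
        Ideal.Quotient.mk (Ideal.span {(9 * D : 𝓞 K3)}) β₀) =
        (primElts D N).filter (fun α ↦ α - β₀ ∈ Ideal.span {9 * D}) :=
      Finset.filter_congr fun α _ ↦ Ideal.Quotient.eq
    rw [e]
    exact norm_sum_fibre_le r m hD0 hm N β₀
  calc ∑ q, ‖∑ α ∈ (primElts D N).filter (fun α ↦ Ideal.Quotient.mk (Ideal.span {(9 * D : 𝓞 K3)}) α = q),
          grossenNu D r m (Ideal.span {α})‖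
      ≤ ∑ _q : 𝓞 K3 ⧸ Ideal.span {(9 * D : 𝓞 K3)}, Cw * m * ((Real.sqrt N + 1) * (Real.sqrt (Real.sqrt N) + 1)) :=
        Finset.sum_le_sum fun q _ ↦ hfib q
    _ = _ := by
        rw [Finset.sum_const, Finset.card_univ, nsmul_eq_mul, card_quotient_eq]
        ring

/-- **Clean form**: `‖Σ_{n ≤ N} a_ν(n)‖ ≤ (4 C_w N(9D) m) · N^{3/4}` for `N ≥ 1`, the hypothesis of
`LSeriesContinuationOfPartialSums` with `θ = 3/4`. [cite: HeckeMathZ1920, §6] -/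
theorem norm_sum_twistCount_grossenNu_le_rpow (hD0 : D ≠ 0) (hm : 1 ≤ m) {N : ℕ} (hN : 1 ≤ N) :
    ‖∑ n ∈ Finset.Icc 1 N, twistCount K3 (grossenNu D r m) n‖ ≤
      (4 * Cw * Ideal.absNorm (Ideal.span {(9 * D : 𝓞 K3)}) * m) * (N : ℝ) ^ (3 / 4 : ℝ) := by
  refine (norm_sum_twistCount_grossenNu_le r m hD0 hm N).trans ?_
  have hN1 : (1 : ℝ) ≤ N := by exact_mod_cast hN
  have hs1 : 1 ≤ Real.sqrt N := Real.one_le_sqrt.mpr hN1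
  have hss1 : 1 ≤ Real.sqrt (Real.sqrt N) := Real.one_le_sqrt.mpr hs1
  have hprod : (Real.sqrt N + 1) * (Real.sqrt (Real.sqrt N) + 1) ≤ 4 * (N : ℝ) ^ (3 / 4 : ℝ) := by
    have e : (N : ℝ) ^ (3 / 4 : ℝ) = Real.sqrt N * Real.sqrt (Real.sqrt N) := by
      rw [Real.sqrt_eq_rpow, Real.sqrt_eq_rpow, ← Real.rpow_mul (by positivity),
        ← Real.rpow_add (by positivity)]
      norm_num
    rw [e]
    nlinarith [mul_nonneg (sub_nonneg.mpr hs1) (sub_nonneg.mpr hss1), hs1, hss1]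
  have hC : 0 ≤ (Ideal.absNorm (Ideal.span {(9 * D : 𝓞 K3)}) : ℝ) * Cw * m := by
    have := Cw_pos; positivity
  calc (Ideal.absNorm (Ideal.span {(9 * D : 𝓞 K3)}) : ℝ) * Cw * m *
        ((Real.sqrt N + 1) * (Real.sqrt (Real.sqrt N) + 1))
      ≤ (Ideal.absNorm (Ideal.span {(9 * D : 𝓞 K3)}) : ℝ) * Cw * m * (4 * (N : ℝ) ^ (3 / 4 : ℝ)) := by
        gcongr
    _ = _ := by ring

end Sums

end Literature.NumberTheory.LFunctions.EisensteinGrossen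

end
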